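import Summits.QuantumFields.BalabanUV.Beta.WilsonBiStencilWardEntry

/-!
# The (T2-S₂) Wilson table law at level 0, TRACED OVER THE FLUCTUATION COLOUR, on every finite lattice: the background divergence of the
# colour-traced (2,2) table `w22 N` is `−4N²` times the antisymmetrised colourless (2,1) stencil commutated with the site indicator —
# NO remainder (β sub-cell, row D1, (L4) W-side, Ward twin of (W-LET-S₂)₀; D1 formalisation swarm seat `b2b-balaban-beta-d1-formalise-leaf-09`,
# gen 4; CLAIM «D1-hW-L4-W22-TABLE-WARD», file 3)

HONEST FRAMING (cell charter, verbatim): «discharging `BetaPertH` makes Bałaban's UV stability UNCONDITIONAL — a real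
constructive-QFT result; it is NOT the continuum limit and NOT the Clay problem.»  HONEST DEPENDENCY (cell records, verbatim):
«continuum YM on T⁴ ⇐ BetaPertH ∧ nine spine estimates (0/9 proved); BetaPertH ⇐ (D1) ∧ (D4) ∧ CAP+tail; G-an2-4 gates asym, D1 and
NE2/3/4.»  DERIVED cell leaf: finite-dimensional algebra over an arbitrary finite abelian lattice, no estimate, no limit, nothing cited —
every statement is kernel-proved here ([folklore]); no `[cite:]` tag, no `def`, no `def … : Prop`.  By itself this file instantiates NO
binder of the β-function wall.  NOT D1, NOT `BetaPertH`, NOT continuum, NOT Clay.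
ABSOLUTE RULE (cell charter, verbatim): «No internally-minted statement may enter as a cited fact. Every hypothesis is either
kernel-proved in this package or a verbatim quotation of a PUBLISHED theorem with page reference. The manuscript(s) under audit are
NOT citable for their own disputed steps — they are the thing under adjudication; programme-internal (2001/route/tribunal) claims are
never citable.»

## What

File 2 (`WilsonBiStencilWardEntry.bgWard22_entry_colour`) is the second-order background-gauge Ward identity ENTRYWISE WITH COLOUR, for any
letter family.  Here the letters are Bałaban's (`𝔸 = Matrix (Fin N) (Fin N) ℂ` with the `L∞`-operator norm instances
`open scoped Matrix.Norms.Operator` = an3's `Matrix.linftyOpNormedRing/Algebra`, `t = gen τ` for a `Complete`, `TrOrthonormal` family `τ`,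
trace `rntr`, background letter `gen τ c′`, gauge letter `gen τ c`) and the FLUCTUATION COLOUR IS TRACED (`a = b`, `Σ_a` — the colour-blind
one-loop contraction sees the (2,2) table only through this trace).  §1: on the first summand the colour words of the extended family are
those of the family (`cwordV_rotFam_inl`, by `rfl`), so the `(2,2)` blocks at the spare colours are an3's `cwordV`-weighted `bondPairTab`
sums (`wilsonVertex₂_rotFam_spare_apply`), and their colour traces are an3's `sum_cwordV_diag`/`bondPairTab_w22_eq_sum`:
**`Σ_a wV₂ T (⋆0) (⋆1) (a,a) = [c′ = c]·bondPairTab (w22 N)`** (`sum_wilsonVertex₂_spare₀₁_diag`, `…spare₁₀_diag`).  §2: the traces of the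
three `(2,1)` colour numbers of file 2: `Σ_a rntr(t_{c′}·[t_a,[t_c,t_a]]) = [c = c′]·(−2N²)` (= an3's seagull sum `sum_rntr_seagull`, termwise by
cyclicity: `rntr_mul_br_br`), `Σ_a rntr(t_{c′}·[[t_c,t_a],t_a]) = [c = c′]·(2N²)`, and the rotated-letter number VANISHES TERMWISE
(`[t_a, t_a] = 0`: leaf-05-g3's toy finding (B) «no remainder under the trace» is `br_self_eq_zero`).  §3 **`bgWard22_traced_table`** — THE
TRACED TABLE LAW: for every finite lattice `Λ` with frame `e`, `N ≠ 0`, every background bond `(u′, κ′)`, colour `c`, site profile `ℓ`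
and colourless fluctuation legs `(x, α)`, `(z, β)`:
`Σ_{x′} Σ_μ (ℓ x′ − ℓ (x′ + e_μ)) · W22tr(u′κ′; x′μ)((x,α),(z,β)) = −(4·N²) · (ℓ z − ℓ x) · S₀A e u′ κ′ (x,α) (z,β)`,
`W22tr(b; b′)(p,q) := bondPairTab (w22 N) b b′ p q + bondPairTab (w22 N) b′ b p q + bondPairTab (w22 N) b b′ q p + bondPairTab (w22 N) b′ b q p`
(the colour-traced two-bond table symmetrised in both slot pairs), `S₀A` = an3's antisymmetrised colourless `(2,1)` stencil
(`WilsonReflectionFrame.S₀A`; on `ℤ^{d+1}` its entries are an2's `StepJetData.wilsonA` field block, `WilsonReflectionContact.wilsonA_inl_inl`);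
and at the site delta `ℓ = δ_u`, **`bgWard22_traced_div`**:
`Σ_μ (W22tr(u′κ′; u μ) − W22tr(u′κ′; u − e_μ, μ))((x,α),(z,β)) = −(4·N²) · ([z = u] − [x = u]) · S₀A e u′ κ′ (x,α) (z,β)`
— the (2,2) twin of leaf-05-g2's `WilsonStencilDivergence.S₀A_div`: the divergence of the traced Wilson (2,2) table in one background slot
is the commutator of the FIRST-order table with the generator of the gauge rotation at `u` acting on the fluctuation legs at their base
sites, with NO remainder and NO second-order generator — exactly the shape of the hW socket `hS₂` (`KernelWardSymAssembly`, `R = 0`, `X₂ = 0`).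
NOT HERE (file 4, same claim): the slot-symmetry bookkeeping `W22tr ↔ wilsonW₂ d (wsym22 N)` / leaf-09-g3's `wq`, the transport to `ℤ^{d+1}`
(`WilsonStencilTransport.castVec`) and the packed-fibre socket form `divV (κ u ↦ wilsonW₂ …) = C • conjV (wilsonA …) (diagK (legInd ρ u))`;
which multiple of `w22` is the (L4-D) literal's `T` is the units/colour owners' pin ((R45)/(P6)), not asserted here.
Provenance: pub-balaban β sub-cell, D1 formalisation swarm, unit `b2b-balaban-beta-d1-formalise-leaf-09` gen 4, 2026-08-20 (v1); over files
1–2 and an3's `WilsonVertex2Kron` / `PlaquetteVertex2Trace` / `PlaquetteVertex2Words` BY NAME; no existing file touched.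
-/

namespace Summit.QuantumFields.BalabanUV.Beta.WilsonBiStencilWardTrace

open Finset
open scoped BigOperators Matrix
open Literature.MathematicalPhysics.QuantumFieldTheory.Balaban1983to89.Beta
open Literature.MathematicalPhysics.QuantumFieldTheory.Balaban1983to89.Beta.SpinTable (br)
open Literature.MathematicalPhysics.QuantumFieldTheory.Balaban1983to89.Beta.ColourTrace (Complete TrOrthonormal)
open Literature.MathematicalPhysics.QuantumFieldTheory.Balaban1983to89.Beta.PlaquetteVertex (field adM adM_apply bondLetter rntr rntr_comm
  gen)
open Literature.MathematicalPhysics.QuantumFieldTheory.Balaban1983to89.Beta.PlaquetteStencil (wilsonVertex₁)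
open Literature.MathematicalPhysics.QuantumFieldTheory.Balaban1983to89.Beta.PlaquetteVertex2Trace (w22 sum_rntr_seagull)
open Literature.MathematicalPhysics.QuantumFieldTheory.Balaban1983to89.Beta.WilsonVertexKron (wilsonStencil₀ wilsonVertex₁_apply_eq_mul)
open Literature.MathematicalPhysics.QuantumFieldTheory.Balaban1983to89.Beta.WilsonVertex2Kron (cwordV cmat stab kap wilsonVertex₂
  wilsonVertex₂_apply bondPairTab sum_cwordV_diag bondPairTab_w22_eq_sum)
open Summit.QuantumFields.BalabanUV.Beta.WilsonReflectionFrame (S₀A)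
open Summit.QuantumFields.BalabanUV.Beta.WilsonBiStencilWardFrame
open Summit.QuantumFields.BalabanUV.Beta.WilsonBiStencilWardEntry

/-! ## §1 The `(2,2)` blocks of the extended family at the spare colours, and their colour traces -/

section Words

variable {𝔸 : Type*} [NormedRing 𝔸] [NormedAlgebra ℝ 𝔸] {C : Type*} {ι : Type*}

/-- [folklore] on the first summand the colour words of the extended family are the family's own (the words see `t` only through `t a`, `t b`). -/
theorem cwordV_rotFam_inl (τ : 𝔸 →ₗ[ℝ] ℝ) (t : C → 𝔸) (Yr : 𝔸) (y : ι → 𝔸) (X X' : 𝔸) (a b : C) (w : Fin 9) :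
    cwordV τ (rotFam t Yr y) X X' (Sum.inl a) (Sum.inl b) w = cwordV τ t X X' a b w := rfl

variable {Λ : Type*} [DecidableEq Λ] [AddCommGroup Λ] {D : Type*} [Fintype D] [DecidableEq D]

/-- [folklore] **THE `(2,2)` BLOCK AT TWO SPARE BACKGROUND COLOURS, READ ON THE FIRST SUMMAND**: an3's word decomposition with the spare
letters as background letters and the family's letters on the fluctuation legs. -/
theorem wilsonVertex₂_rotFam_spare_apply (τ : 𝔸 →ₗ[ℝ] ℝ) (t : C → 𝔸) (Yr : 𝔸) (y : ι → 𝔸) (e : D → Λ) (u₁ : Λ) (i : ι) (κ₁ : D)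
    (u₂ : Λ) (j : ι) (κ₂ : D) (x : Λ) (a : C) (α : D) (z : Λ) (b : C) (β : D) :
    wilsonVertex₂ τ (rotFam t Yr y) e (u₁, (Sum.inr (Sum.inr i), κ₁)) (u₂, (Sum.inr (Sum.inr j), κ₂)) (x, (Sum.inl a, α)) (z, (Sum.inl b, β)) =
      ∑ w, cwordV τ t (y i) (y j) a b w * bondPairTab e u₁ κ₁ u₂ κ₂ (fun i' j' k l => stab i' j' k l w) (x, α) (z, β) := by
  rw [wilsonVertex₂_apply]
  rfl

end Words

section Traces

open scoped Matrix.Norms.Operator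

variable {N : ℕ} {C : Type*} [Fintype C] [DecidableEq C]
variable {Λ : Type*} [DecidableEq Λ] [AddCommGroup Λ] {D : Type*} [Fintype D] [DecidableEq D]

/-- [folklore] **THE COLOUR TRACE OF THE `(2,2)` BLOCK `(⋆0, ⋆1)` IS THE TRACED TABLE `w22 N`** (Bałaban's letters; an3's `sum_cwordV_diag` and
`bondPairTab_w22_eq_sum`): `Σ_a wV₂ T (u₁,⋆0,κ₁) (u₂,⋆1,κ₂) ((x,a,α),(z,a,β)) = [c′ = c]·bondPairTab (w22 N) (u₁κ₁;u₂κ₂) (x,α) (z,β)`. -/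
theorem sum_wilsonVertex₂_spare₀₁_diag {τ : C → Matrix (Fin N) (Fin N) ℂ} (hτ : Complete τ) (ho : TrOrthonormal τ) (hN : N ≠ 0)
    (Yr : Matrix (Fin N) (Fin N) ℂ) (c' c : C) (e : D → Λ) (u₁ : Λ) (κ₁ : D) (u₂ : Λ) (κ₂ : D) (x : Λ) (α : D) (z : Λ) (β : D) :
    ∑ a, wilsonVertex₂ rntr (rotFam (gen τ) Yr ![gen τ c', gen τ c]) e (u₁, (Sum.inr (Sum.inr 0), κ₁)) (u₂, (Sum.inr (Sum.inr 1), κ₂))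
        (x, (Sum.inl a, α)) (z, (Sum.inl a, β)) =
      if c' = c then bondPairTab e u₁ κ₁ u₂ κ₂ (w22 N) (x, α) (z, β) else 0 := by
  simp only [wilsonVertex₂_rotFam_spare_apply, Matrix.cons_val_zero, Matrix.cons_val_one]
  rw [Finset.sum_comm]
  simp only [← Finset.sum_mul, sum_cwordV_diag hτ ho hN]
  split_ifs with h
  · rw [bondPairTab_w22_eq_sum, Matrix.sum_apply]
    exact Finset.sum_congr rfl fun w _ => by rw [Matrix.smul_apply, smul_eq_mul]
  · simp

/-- [folklore] the same for the block `(⋆1, ⋆0)` (background slots exchanged). -/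
theorem sum_wilsonVertex₂_spare₁₀_diag {τ : C → Matrix (Fin N) (Fin N) ℂ} (hτ : Complete τ) (ho : TrOrthonormal τ) (hN : N ≠ 0)
    (Yr : Matrix (Fin N) (Fin N) ℂ) (c' c : C) (e : D → Λ) (u₁ : Λ) (κ₁ : D) (u₂ : Λ) (κ₂ : D) (x : Λ) (α : D) (z : Λ) (β : D) :
    ∑ a, wilsonVertex₂ rntr (rotFam (gen τ) Yr ![gen τ c', gen τ c]) e (u₁, (Sum.inr (Sum.inr 1), κ₁)) (u₂, (Sum.inr (Sum.inr 0), κ₂))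
        (x, (Sum.inl a, α)) (z, (Sum.inl a, β)) =
      if c' = c then bondPairTab e u₁ κ₁ u₂ κ₂ (w22 N) (x, α) (z, β) else 0 := by
  simp only [wilsonVertex₂_rotFam_spare_apply, Matrix.cons_val_zero, Matrix.cons_val_one]
  rw [Finset.sum_comm]
  simp only [← Finset.sum_mul, sum_cwordV_diag hτ ho hN]
  by_cases hc : c' = c
  · subst hc
    simp only [if_true]
    rw [bondPairTab_w22_eq_sum, Matrix.sum_apply]
    exact Finset.sum_congr rfl fun w _ => by rw [Matrix.smul_apply, smul_eq_mul]
  · have hc' : ¬c = c' := fun h => hc h.symm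
    simp [hc, hc']

/-! ## §2 The colour traces of the three `(2,1)` numbers -/

omit [DecidableEq C] in
/-- [folklore] `X·[A,[Z,A]]` and `[Z,A]·[X,A]` have the same trace (cyclicity only). -/
theorem rntr_mul_br_br (X A Z : Matrix (Fin N) (Fin N) ℂ) : rntr (X * br A (br Z A)) = rntr (br Z A * br X A) := by
  have f1 : rntr (Z * A * X * A) = rntr (X * A * Z * A) := by rw [mul_assoc (Z * A) X A, rntr_comm, ← mul_assoc]
  have f2 : rntr (Z * A * A * X) = rntr (X * Z * A * A) := by rw [rntr_comm (Z * A * A) X, ← mul_assoc, ← mul_assoc]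
  have f3 : rntr (A * Z * X * A) = rntr (X * A * A * Z) := by
    rw [rntr_comm (A * Z * X) A, ← mul_assoc, ← mul_assoc, rntr_comm (A * A * Z) X, ← mul_assoc, ← mul_assoc]
  have f4 : rntr (A * Z * A * X) = rntr (X * A * Z * A) := by rw [rntr_comm (A * Z * A) X, ← mul_assoc, ← mul_assoc]
  simp only [br, mul_sub, sub_mul, map_sub, ← mul_assoc]
  rw [f1, f2, f3, f4]

/-- [folklore] **THE CONJUGATION NUMBER TRACES TO THE SEAGULL**: `Σ_a rntr(t_{c′}·[t_a,[t_c,t_a]]) = [c = c′]·(−2N²)` (an3's `sum_rntr_seagull`). -/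
theorem sum_rntr_conj₁ {τ : C → Matrix (Fin N) (Fin N) ℂ} (hτ : Complete τ) (ho : TrOrthonormal τ) (hN : N ≠ 0) (c c' : C) :
    ∑ a, rntr (gen τ c' * br (gen τ a) (gen τ c * gen τ a - gen τ a * gen τ c)) = if c = c' then -(2 * (N : ℝ) ^ 2) else 0 := by
  rw [← sum_rntr_seagull hτ ho hN c c']
  exact Finset.sum_congr rfl fun a _ => rntr_mul_br_br _ _ _

/-- [folklore] the second conjugation number is minus the first: `Σ_a rntr(t_{c′}·[[t_c,t_a],t_a]) = [c = c′]·(2N²)`. -/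
theorem sum_rntr_conj₂ {τ : C → Matrix (Fin N) (Fin N) ℂ} (hτ : Complete τ) (ho : TrOrthonormal τ) (hN : N ≠ 0) (c c' : C) :
    ∑ a, rntr (gen τ c' * br (gen τ c * gen τ a - gen τ a * gen τ c) (gen τ a)) = if c = c' then 2 * (N : ℝ) ^ 2 else 0 := by
  have h : ∀ a, rntr (gen τ c' * br (gen τ c * gen τ a - gen τ a * gen τ c) (gen τ a)) =
      -rntr (gen τ c' * br (gen τ a) (gen τ c * gen τ a - gen τ a * gen τ c)) := by
    intro a
    rw [← map_neg]
    congr 1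
    simp only [br]
    noncomm_ring
  simp only [h, Finset.sum_neg_distrib, sum_rntr_conj₁ hτ ho hN]
  split_ifs <;> ring

omit [Fintype C] [DecidableEq C] in
/-- [folklore] **THE ROTATED-LETTER NUMBER VANISHES ON THE COLOUR DIAGONAL** (`[t_a, t_a] = 0`). -/
theorem rntr_mul_br_self (X A : Matrix (Fin N) (Fin N) ℂ) : rntr (X * br A A) = 0 := by
  simp [br]

/-! ## §3 The traced table law -/

variable [Fintype Λ]

/-- [folklore] **THE (T2-S₂) WILSON TABLE LAW AT LEVEL 0, TRACED, ON A FINITE LATTICE** (see the module docstring): for the colour-traced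
two-bond table `w22 N` symmetrised in both slot pairs and the antisymmetrised colourless first-order stencil `S₀A`,
`Σ_{x′} Σ_μ (ℓ x′ − ℓ (x′ + e_μ)) · W22tr(u′κ′; x′μ)((x,α),(z,β)) = −(4·N²)·(ℓ z − ℓ x)·S₀A e u′ κ′ (x,α) (z,β)`. -/
theorem bgWard22_traced_table {τ : C → Matrix (Fin N) (Fin N) ℂ} (hτ : Complete τ) (ho : TrOrthonormal τ) (hN : N ≠ 0) (c : C)
    (e : D → Λ) (u' : Λ) (κ' : D) (ell : Λ → ℝ) (x : Λ) (α : D) (z : Λ) (β : D) :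
    ∑ x' : Λ, ∑ μ : D, (ell x' - ell (x' + e μ)) *
        (bondPairTab e u' κ' x' μ (w22 N) (x, α) (z, β) + bondPairTab e x' μ u' κ' (w22 N) (x, α) (z, β)
          + bondPairTab e u' κ' x' μ (w22 N) (z, β) (x, α) + bondPairTab e x' μ u' κ' (w22 N) (z, β) (x, α)) =
      -(4 * (N : ℝ) ^ 2) * (ell z - ell x) * S₀A e u' κ' (x, α) (z, β) := by
  -- the entrywise law with colour at `Y = Y′ = gen τ c`, summed over the fluctuation colour diagonal
  have h := fun a : C => bgWard22_entry_colour_eval rntr rntr_comm (gen τ) (gen τ c) (gen τ c) e u' κ' ell x a α z a β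
  have hs := Finset.sum_eq_zero fun (a : C) (_ : a ∈ (Finset.univ : Finset C)) => h a
  -- the four colour traces
  have t₁ := sum_rntr_conj₁ hτ ho hN c c
  have t₂ := sum_rntr_conj₂ hτ ho hN c c
  rw [if_pos rfl] at t₁ t₂
  have tH : ∀ (px : Λ) (pα : D) (qx : Λ) (qβ : D), ∑ a : C, (∑ x' : Λ, ∑ μ : D, (ell x' - ell (x' + e μ)) •
      (wilsonVertex₂ rntr (rotFam (gen τ) (gen τ c) ![gen τ c, gen τ c]) e (u', (Sum.inr (Sum.inr 0), κ')) (x', (Sum.inr (Sum.inr 1), μ))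
        + wilsonVertex₂ rntr (rotFam (gen τ) (gen τ c) ![gen τ c, gen τ c]) e (x', (Sum.inr (Sum.inr 1), μ)) (u', (Sum.inr (Sum.inr 0), κ'))))
        (px, (Sum.inl a, pα)) (qx, (Sum.inl a, qβ)) =
      ∑ x' : Λ, ∑ μ : D, (ell x' - ell (x' + e μ)) *
        (bondPairTab e u' κ' x' μ (w22 N) (px, pα) (qx, qβ) + bondPairTab e x' μ u' κ' (w22 N) (px, pα) (qx, qβ)) := by
    intro px pα qx qβ
    simp only [Matrix.sum_apply, Matrix.smul_apply, Matrix.add_apply, smul_eq_mul]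
    rw [Finset.sum_comm]
    refine Finset.sum_congr rfl fun x' _ => ?_
    rw [Finset.sum_comm]
    refine Finset.sum_congr rfl fun μ _ => ?_
    rw [← Finset.mul_sum, Finset.sum_add_distrib, sum_wilsonVertex₂_spare₀₁_diag hτ ho hN, sum_wilsonVertex₂_spare₁₀_diag hτ ho hN,
      if_pos rfl, if_pos rfl]
  have tHx := tH x α z β
  have tHz := tH z β x α
  -- trace the law
  simp only [Finset.sum_add_distrib, Finset.sum_sub_distrib, ← Finset.mul_sum, ← Finset.sum_mul, rntr_mul_br_self, zero_mul,
    Finset.sum_const_zero, mul_zero, tHx, tHz, t₁, t₂] at hs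
  unfold S₀A
  have e4 : ∑ x' : Λ, ∑ μ : D, (ell x' - ell (x' + e μ)) *
        (bondPairTab e u' κ' x' μ (w22 N) (x, α) (z, β) + bondPairTab e x' μ u' κ' (w22 N) (x, α) (z, β)
          + bondPairTab e u' κ' x' μ (w22 N) (z, β) (x, α) + bondPairTab e x' μ u' κ' (w22 N) (z, β) (x, α)) =
      (∑ x' : Λ, ∑ μ : D, (ell x' - ell (x' + e μ)) *
        (bondPairTab e u' κ' x' μ (w22 N) (x, α) (z, β) + bondPairTab e x' μ u' κ' (w22 N) (x, α) (z, β)))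
      + ∑ x' : Λ, ∑ μ : D, (ell x' - ell (x' + e μ)) *
        (bondPairTab e u' κ' x' μ (w22 N) (z, β) (x, α) + bondPairTab e x' μ u' κ' (w22 N) (z, β) (x, α)) := by
    rw [← Finset.sum_add_distrib]
    refine Finset.sum_congr rfl fun x' _ => ?_
    rw [← Finset.sum_add_distrib]
    refine Finset.sum_congr rfl fun μ _ => ?_
    ring
  rw [e4]
  linear_combination (1 / 4 : ℝ) * hs

omit [DecidableEq D] in
/-- [folklore] the site-delta profile: `Σ_{x′} Σ_μ ([x′ = u] − [x′ + e_μ = u])·F x′ μ = Σ_μ (F u μ − F (u − e_μ) μ)`. -/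
theorem sum_siteDelta_profile (e : D → Λ) (u : Λ) (F : Λ → D → ℝ) :
    ∑ x' : Λ, ∑ μ : D, ((if x' = u then (1 : ℝ) else 0) - (if x' + e μ = u then 1 else 0)) * F x' μ =
      ∑ μ : D, (F u μ - F (u - e μ) μ) := by
  rw [Finset.sum_comm]
  refine Finset.sum_congr rfl fun μ _ => ?_
  simp only [sub_mul, Finset.sum_sub_distrib, ite_mul, one_mul, zero_mul, Finset.sum_ite_eq', Finset.mem_univ, if_true]
  congr 1
  rw [Finset.sum_eq_single (u - e μ)]
  · rw [if_pos (sub_add_cancel u (e μ))]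
  · intro x' _ hx'
    rw [if_neg]
    intro h
    exact hx' (by rw [← h, add_sub_cancel_right])
  · intro h; exact absurd (Finset.mem_univ _) h

/-- [folklore] **THE BACKGROUND DIVERGENCE OF THE TRACED WILSON (2,2) TABLE AT A SITE** (the (2,2) twin of `WilsonStencilDivergence.S₀A_div`):
`Σ_μ (W22tr(u′κ′; u μ) − W22tr(u′κ′; u − e_μ, μ))((x,α),(z,β)) = −(4·N²)·([z = u] − [x = u])·S₀A e u′ κ′ (x,α) (z,β)`. -/
theorem bgWard22_traced_div {τ : C → Matrix (Fin N) (Fin N) ℂ} (hτ : Complete τ) (ho : TrOrthonormal τ) (hN : N ≠ 0) (c : C)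
    (e : D → Λ) (u' : Λ) (κ' : D) (u : Λ) (x : Λ) (α : D) (z : Λ) (β : D) :
    ∑ μ : D, ((bondPairTab e u' κ' u μ (w22 N) (x, α) (z, β) + bondPairTab e u μ u' κ' (w22 N) (x, α) (z, β)
          + bondPairTab e u' κ' u μ (w22 N) (z, β) (x, α) + bondPairTab e u μ u' κ' (w22 N) (z, β) (x, α))
        - (bondPairTab e u' κ' (u - e μ) μ (w22 N) (x, α) (z, β) + bondPairTab e (u - e μ) μ u' κ' (w22 N) (x, α) (z, β)
          + bondPairTab e u' κ' (u - e μ) μ (w22 N) (z, β) (x, α) + bondPairTab e (u - e μ) μ u' κ' (w22 N) (z, β) (x, α))) =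
      -(4 * (N : ℝ) ^ 2) * ((if z = u then (1 : ℝ) else 0) - (if x = u then 1 else 0)) * S₀A e u' κ' (x, α) (z, β) := by
  have h := bgWard22_traced_table hτ ho hN c e u' κ' (fun y => if y = u then (1 : ℝ) else 0) x α z β
  rw [sum_siteDelta_profile] at h
  exact h

end Traces

end Summit.QuantumFields.BalabanUV.Beta.WilsonBiStencilWardTrace
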